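import Mathlib
import Summits.NavierStokesRegularity.NavierStokesRegularity.Theorems.EulerZoomLiouvillePowerGaugeEulerLiouvilleVirialForm
import Summits.NavierStokesRegularity.NavierStokesRegularity.Theorems.EulerZoomLiouvillePowerGaugeEulerLiouvilleDriftClockMember
import HarnessLib

/-!
# «VIRIAL FORM», II: the ABSOLUTE-BAND virial deficit kill (virial twin of `HasFastVorticalChannel` alternative 4)
# (crux `EulerZoomLiouville.PowerGaugeEulerLiouville` = stmt-NavierStokesRegularity-19832, THE ONE STATEMENT `stub_selfSimilarC2Needle`;
# LEAD ns-typeII-p2 g13, 22:27:45Z «→ ns-ezl-w1 g6 / width: the virial twin of alt 4» — width seat ns-ezl-w1 g6)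

Route `EulerZoomLiouville` (NavierStokesRegularity), crux E.  With `W y = γy + V y` (`selfSimilarTransport γ 0 V`), `ℛ(y) = ⟪y, W y⟫`,
`ℋ = selfSimilarBernoulli γ 0 V P′`, and the forward radial acceleration `a(y) = ‖W y‖² + γ⟪y, W y⟫ + ⟪y, DV(y)(W y)⟫`, the LEAD's
«ANY INWARD DRIFT KILLS» (`Loc.selfSimilar_ae_eq_zero_of_absBandDeficitC2_profile`, `…DriftClockMember`, skeleton alternative 4) kills a `C²`
member as soon as, for ONE width `κb > 0` and floor `a₀ > 0`, every far vortical `ℋ`-high point of the ABSOLUTE inflow band `−κb ≤ ℛ(y) ≤ 0`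
has `a(y) ≥ a₀`.  By the class-free virial form (V1) `a = 2ℋ + 2γ(1−γ)‖y‖² − (1−2γ)ℛ − (2P′ + y·∇P′)` (`VirialForm.radialAcceleration_eq`), on
that band (`ℛ ≤ 0`, `γ ≤ ½`, `ℋ > h`) the floor follows from the VIRIAL DEFICIT `2P′(y) + ⟪y, ∇P′(y)⟫ ≤ 2h + 2γ(1−γ)‖y‖² − a₀`:

* (V1″) `VirialForm.absBandDeficit_of_virialDeficit` — the pointwise implication (class-free);
* (V2″) **`Loc.selfSimilar_ae_eq_zero_of_absVirialDeficitC2_profile`** — MEMBER LEVEL: crux hypotheses verbatim, `0 < ρ ≤ ½`, exact self-similarity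
  about the origin, `V ∈ C²`, and «∃ κb a₀ > 0 ∀ P′ ∀ h ∃ R₀: every vortical `ℋ_{P′}`-high point with `‖y‖ ≥ R₀` and `−κb ≤ ⟪y, W y⟫ ≤ 0` has
  `2P′(y) + ⟪y, ∇P′(y)⟫ ≤ 2h + 2γ(1−γ)‖y‖² − a₀`» ⇒ trivial;
* **`Past.selfSimilar_ae_eq_zero_of_absVirialDeficitC2_profile_past`** — the past-exact twin.

Reading for THE ONE STATEMENT: for all `κb, a₀ > 0` the needle has, beyond every radius, vortical Bernoulli-high points, circular to order `1/‖y‖`,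
that are VIRIAL-SUPPORTED TO ORDER ONE: `2P′ + y·∇P′ > 2h + 2γ(1−γ)‖y‖² − a₀`.

WHAT THIS IS NOT: not NS, not E — a pointwise identity and by-name corollaries on the model lattice, `--supports` stmt-19832; DENT 0 on the
registered stubs; 19832 OPEN; NS regularity is NOT proved; no summit statement is proved by this seat.
[folklore; cf. ConstantinIgnatovaVicol2026Putative §3.1.1 (3.3), §3.4.3 (3.30)]
-/

noncomputable section

-- flat `Theorems/<Route><Decl>…` files of one crux share the namespace of the crux (tree convention: `Summit.<S>.<S>.…`)
set_option linter.dupNamespace false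

open Set Filter Topology Metric Function MeasureTheory
open scoped RealInnerProductSpace NNReal ENNReal

namespace Summit.NavierStokesRegularity.NavierStokesRegularity.Theorems.PowerGaugeEulerLiouville

open Literature.Analysis Literature.Analysis.FluidPDE

namespace VirialForm

variable {γ : ℝ} {V : EuclideanSpace ℝ (Fin 3) → EuclideanSpace ℝ (Fin 3)} {P : EuclideanSpace ℝ (Fin 3) → ℝ}

/-- **(V1″) FROM THE ABSOLUTE VIRIAL DEFICIT TO THE ABSOLUTE-BAND FLOOR** (class-free, pointwise): for a classical profile with `γ ≤ ½`, at a point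
with `ℋ(y) > h`, `⟪y, W y⟫ ≤ 0` and `2P(y) + ⟪y, ∇P(y)⟫ ≤ 2h + 2γ(1−γ)‖y‖² − a₀`, the radial acceleration satisfies `a(y) ≥ a₀`. [folklore] -/
theorem absBandDeficit_of_virialDeficit (hprof : IsSelfSimilarEulerProfile γ 0 V P) (hγ : γ ≤ 1 / 2) {a₀ h : ℝ}
    {y : EuclideanSpace ℝ (Fin 3)} (hh : h < selfSimilarBernoulli γ 0 V P y)
    (hR : ⟪y, selfSimilarTransport γ 0 V y⟫ ≤ 0)
    (hvir : 2 * P y + ⟪y, gradient P y⟫ ≤ 2 * h + 2 * γ * (1 - γ) * ‖y‖ ^ 2 - a₀) :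
    a₀ ≤ ‖selfSimilarTransport γ 0 V y‖ ^ 2 + γ * ⟪y, selfSimilarTransport γ 0 V y⟫ +
      ⟪y, fderiv ℝ V y (selfSimilarTransport γ 0 V y)⟫ := by
  rw [radialAcceleration_eq hprof y]
  have h1 : 0 ≤ -((1 - 2 * γ) * ⟪y, selfSimilarTransport γ 0 V y⟫) := by
    rw [neg_mul_eq_neg_mul]
    exact mul_nonneg_of_nonpos_of_nonpos (by linarith) hR
  linarith

end VirialForm

/-- **(V2″) EXACTLY SELF-SIMILAR MEMBERS WHOSE `C²` PROFILE HAS A VIRIAL DEFICIT ON THE FAR VORTICAL BERNOULLI-HIGH ABSOLUTE INFLOW BAND ARE TRIVIAL.**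
Crux hypotheses verbatim (`0 < ρ ≤ ½`, `γ = 1/(2+ρ)`), exact self-similarity about the origin, `V ∈ C²`; for ONE pair `κb > 0`, `a₀ > 0`, every classical
pressure `P′` of the profile and every level `h` there is `R₀` such that every point `y` with `‖y‖ ≥ R₀`, `ℋ_{P′}(y) > h`, `curl V y ≠ 0`,
`−κb ≤ ⟪y, W y⟫ ≤ 0` has `2P′(y) + ⟪y, ∇P′(y)⟫ ≤ 2h + 2γ(1−γ)‖y‖² − a₀`.  Then `u = 0` a.e. on the slab (`VirialForm.absBandDeficit_of_virialDeficit` ∘ the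
LEAD's `Loc.selfSimilar_ae_eq_zero_of_absBandDeficitC2_profile`). [folklore; cf. ConstantinIgnatovaVicol2026Putative §3.4–§3.5] -/
theorem Loc.selfSimilar_ae_eq_zero_of_absVirialDeficitC2_profile {ρ : ℝ} (hρ : 0 < ρ) (hρ1 : ρ ≤ 1 / 2)
    {u : ℝ → EuclideanSpace ℝ (Fin 3) → EuclideanSpace ℝ (Fin 3)} {p : ℝ → EuclideanSpace ℝ (Fin 3) → ℝ}
    {H : ℝ → EuclideanSpace ℝ (Fin 3) → EuclideanSpace ℝ (Fin 3) →L[ℝ] EuclideanSpace ℝ (Fin 3)} {c : ℝ≥0}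
    (hsw : IsSuitableWeakSolutionOn (slab (EuclideanSpace ℝ (Fin 3)) (Iio 0) isOpen_Iio) 0 0 u p)
    (hH : HasWeakSpatialGradientOn (slab (EuclideanSpace ℝ (Fin 3)) (Iio 0) isOpen_Iio) u H)
    (hgauge : ∀ a : ℝ, 0 < a →
      ENNReal.ofReal (a ^ (2 * ρ)) * cknA a (0 : ℝ × EuclideanSpace ℝ (Fin 3)) u +
          ENNReal.ofReal (a ^ ρ) * cknE a (0 : ℝ × EuclideanSpace ℝ (Fin 3)) H +
        ENNReal.ofReal (a ^ (2 * ρ)) * cknD a (0 : ℝ × EuclideanSpace ℝ (Fin 3)) p ≤ (c : ℝ≥0∞))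
    {V : EuclideanSpace ℝ (Fin 3) → EuclideanSpace ℝ (Fin 3)} {P : EuclideanSpace ℝ (Fin 3) → ℝ}
    (hu : ∀ τ : ℝ, τ < 0 → u τ = selfSimilarCollapse (1 / (2 + ρ)) 0 V τ)
    (hp : ∀ τ : ℝ, τ < 0 → p τ = selfSimilarCollapsePressure (1 / (2 + ρ)) 0 P τ)
    (hV : ContDiff ℝ 2 V) {κb a₀ : ℝ} (hκb : 0 < κb) (ha₀ : 0 < a₀)
    (hVir : ∀ P' : EuclideanSpace ℝ (Fin 3) → ℝ, IsSelfSimilarEulerProfile (1 / (2 + ρ)) 0 V P' →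
      ∀ h : ℝ, ∃ R₀ : ℝ, ∀ y : EuclideanSpace ℝ (Fin 3), R₀ ≤ ‖y‖ →
        h < selfSimilarBernoulli (1 / (2 + ρ)) 0 V P' y → curl V y ≠ 0 →
          -κb ≤ ⟪y, selfSimilarTransport (1 / (2 + ρ)) 0 V y⟫ →
          ⟪y, selfSimilarTransport (1 / (2 + ρ)) 0 V y⟫ ≤ 0 →
          2 * P' y + ⟪y, gradient P' y⟫ ≤ 2 * h + 2 * (1 / (2 + ρ)) * (1 - 1 / (2 + ρ)) * ‖y‖ ^ 2 - a₀) :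
    uncurry u =ᵐ[volume.restrict (Iio (0 : ℝ) ×ˢ (univ : Set (EuclideanSpace ℝ (Fin 3))))] 0 := by
  have hγ : 1 / (2 + ρ) ≤ 1 / 2 := one_div_le_one_div_of_le (by norm_num) (by linarith)
  refine Loc.selfSimilar_ae_eq_zero_of_absBandDeficitC2_profile hρ hρ1 hsw hH hgauge hu hp hV hκb ha₀
    fun P' hprof h => ?_
  obtain ⟨R₀, hR₀⟩ := hVir P' hprof h
  exact ⟨R₀, fun y hy hh hcurl hlo hhi =>
    VirialForm.absBandDeficit_of_virialDeficit hprof hγ hh hhi (hR₀ y hy hh hcurl hlo hhi)⟩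

namespace Past

variable {ρ T T₁ : ℝ}
  {u : ℝ → EuclideanSpace ℝ (Fin 3) → EuclideanSpace ℝ (Fin 3)} {p : ℝ → EuclideanSpace ℝ (Fin 3) → ℝ}
  {H : ℝ → EuclideanSpace ℝ (Fin 3) → EuclideanSpace ℝ (Fin 3) →L[ℝ] EuclideanSpace ℝ (Fin 3)} {c : ℝ≥0}
  {V : EuclideanSpace ℝ (Fin 3) → EuclideanSpace ℝ (Fin 3)} {P : EuclideanSpace ℝ (Fin 3) → ℝ}

/-- **PAST-EXACT MEMBER WHOSE `C²` PROFILE HAS A VIRIAL DEFICIT ON THE FAR VORTICAL BERNOULLI-HIGH ABSOLUTE INFLOW BAND IS TRIVIAL** (crux hypotheses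
verbatim, `0 < ρ ≤ ½`; exact self-similarity about `(T, x₀)` for `τ < T₁`, `T₁ ≤ 0`, `T₁ ≤ T`; `V ∈ C²`; the absolute virial-deficit hypothesis of
`Loc.selfSimilar_ae_eq_zero_of_absVirialDeficitC2_profile`).  By-name corollary of the LEAD's `Past.selfSimilar_ae_eq_zero_of_absBandDeficitC2_profile_past`.
[folklore; cf. ConstantinIgnatovaVicol2026Putative §3.4–§3.5] -/
theorem selfSimilar_ae_eq_zero_of_absVirialDeficitC2_profile_past (hρ : 0 < ρ) (hρh : ρ ≤ 1 / 2) (hT₁ : T₁ ≤ 0)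
    (hTT₁ : T₁ ≤ T) (x₀ : EuclideanSpace ℝ (Fin 3))
    (hsw : IsSuitableWeakSolutionOn (slab (EuclideanSpace ℝ (Fin 3)) (Iio 0) isOpen_Iio) 0 0 u p)
    (hH : HasWeakSpatialGradientOn (slab (EuclideanSpace ℝ (Fin 3)) (Iio 0) isOpen_Iio) u H)
    (hgauge : ∀ a : ℝ, 0 < a →
      ENNReal.ofReal (a ^ (2 * ρ)) * cknA a (0 : ℝ × EuclideanSpace ℝ (Fin 3)) u +
          ENNReal.ofReal (a ^ ρ) * cknE a (0 : ℝ × EuclideanSpace ℝ (Fin 3)) H +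
        ENNReal.ofReal (a ^ (2 * ρ)) * cknD a (0 : ℝ × EuclideanSpace ℝ (Fin 3)) p ≤ (c : ℝ≥0∞))
    (hu : ∀ τ : ℝ, τ < T₁ → u τ = fun x => selfSimilarCollapse (1 / (2 + ρ)) T V τ (x - x₀))
    (hp : ∀ τ : ℝ, τ < T₁ → p τ = fun x => selfSimilarCollapsePressure (1 / (2 + ρ)) T P τ (x - x₀))
    (hV : ContDiff ℝ 2 V) {κb a₀ : ℝ} (hκb : 0 < κb) (ha₀ : 0 < a₀)
    (hVir : ∀ P' : EuclideanSpace ℝ (Fin 3) → ℝ, IsSelfSimilarEulerProfile (1 / (2 + ρ)) 0 V P' →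
      ∀ h : ℝ, ∃ R₀ : ℝ, ∀ y : EuclideanSpace ℝ (Fin 3), R₀ ≤ ‖y‖ →
        h < selfSimilarBernoulli (1 / (2 + ρ)) 0 V P' y → curl V y ≠ 0 →
          -κb ≤ ⟪y, selfSimilarTransport (1 / (2 + ρ)) 0 V y⟫ →
          ⟪y, selfSimilarTransport (1 / (2 + ρ)) 0 V y⟫ ≤ 0 →
          2 * P' y + ⟪y, gradient P' y⟫ ≤ 2 * h + 2 * (1 / (2 + ρ)) * (1 - 1 / (2 + ρ)) * ‖y‖ ^ 2 - a₀) :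
    uncurry u =ᵐ[volume.restrict (Iio (0 : ℝ) ×ˢ (univ : Set (EuclideanSpace ℝ (Fin 3))))] 0 := by
  have hγ : 1 / (2 + ρ) ≤ 1 / 2 := one_div_le_one_div_of_le (by norm_num) (by linarith)
  refine selfSimilar_ae_eq_zero_of_absBandDeficitC2_profile_past hρ hρh hT₁ hTT₁ x₀ hsw hH hgauge hu hp hV hκb ha₀
    fun P' hprof h => ?_
  obtain ⟨R₀, hR₀⟩ := hVir P' hprof h
  exact ⟨R₀, fun y hy hh hcurl hlo hhi =>
    VirialForm.absBandDeficit_of_virialDeficit hprof hγ hh hhi (hR₀ y hy hh hcurl hlo hhi)⟩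

end Past

end Summit.NavierStokesRegularity.NavierStokesRegularity.Theorems.PowerGaugeEulerLiouville

end
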